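import Literature.NumberTheory.Automorphic.LanglandsTunnellModThree
import Literature.NumberTheory.Automorphic.StrongArtinGL2Proofs
import Literature.NumberTheory.Automorphic.PiOfArtinRepFrobSatakeCompatibleProofs
import Literature.NumberTheory.Automorphic.BCDTModularitySerreProofs
import Literature.NumberTheory.Automorphic.BCDTTheoremB
import Literature.NumberTheory.GaloisRepresentations.ProjectiveTypeSolvable
import Literature.NumberTheory.GaloisRepresentations.ArtinReciprocityCharacter
import Literature.NumberTheory.EllipticCurves.CMNewformOfHeckeCharacter
import Literature.NumberTheory.DiophantineGeometry.LocalReduction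
import Literature.GroupTheory.SpecificGroups.GL2SubgroupOrderDivisibleContainsSL2
import HarnessLib

/-!
# Stub-ideation k1, GENERATION 3 (HOME FAMILY 1 — recognise & import) for `stub_modThree`

Companion of `STUB-IDEAS-stub_modThree-1.md` (gen 3).  Statements only (helpers are `sorry`), plus
two kernel-checked closers.  Delta w.r.t. gen 2 (`STUB_IDEAS_stub_modThree_1.lean`, ns `…K1G2`,
fully proved: H0 oddness, H1 per-`σ` descent, H3 dihedral ∨ octahedral, H4 LT from `π(σ)`, closers
from {`strongArtin_of_isDihedralType`, `strongArtin_of_isOctahedralType`, `exists_isNewform1_of_isPiOfArtinRep`}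
and from Serre₃):

* **Plan S (new)** — *import at the right grain*: `E` semistable away from `3` and `E[3]` absolutely
  irreducible ⇒ `ρ̄_{E,3}` SURJECTIVE (S0 ⇐ S1 group theory in `GL₂(𝔽₃)`, S2 "a `2`-group image
  unramified outside `3∞` is reducible" (only `ℚ(√-3)` is quadratic unramified outside `3`), S3
  semistable ⇒ unipotent inertia).  Hence at the main (semistable Frey) use-site ONLY the octahedral
  leaf of Langlands–Tunnell is ever exercised (`SurjectiveCore`).
* **Plan D (new import for the residual Cartan-normaliser case)** — the dihedral leaf is NOT taken from
  Jacquet–Langlands §12 (`strongArtin_of_isDihedralType`, arbitrary base field, Maass forms, XL) but from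
  the classical ℚ-fact `Ribet1977_cmNewform_of_heckeCharacter` (Γ₁ CM newforms of imaginary quadratic
  Hecke characters; its Γ₀ sibling is PROVED in the tree), applied at the MOD-3 level in HIGHER WEIGHT:
  D1 (`ρ̄ ⊗ 𝔽₉ ≃ Ind_K^ℚ χ̄`, `K` imaginary quadratic: unramifiedness + induced Frobenius polynomials),
  D2 (a type-`(m,0)` Hecke character `ψ` of `K` with `ψ(ϖ_w) ≡ χ̄(Frob_w) mod 𝔓`: Teichmüller lift ×
  a power of the PROVED everywhere-unramified algebraic character), D3 (ramification compatibility of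
  the reciprocity partner — the one CFT risk), D0 (assembly: weight `m+1 ≥ 2` newform + mod-`𝔓`
  descent = gen-2 H1's bookkeeping).
* closers: ★ `stub_modThree_of_cmFact_octahedral` (three named facts, the dihedral one now classical /
  holomorphic / over ℚ) and ★ `isModular_of_isSemistable_awayThree` (semistable use-site from the
  `SurjectiveCore` alone, i.e. from {Tunnell-octahedral, Gelbart 4.2}).

Nothing here is registered; the stub statement is copied verbatim as `StubModThree`.
-/

noncomputable section

open scoped MatrixGroups NumberField Polynomial
open NumberField IsDedekindDomain Polynomial CongruenceSubgroup Field
open Literature.NumberTheory.EllipticCurves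
open Literature.NumberTheory.EllipticCurves.ModularForms
open Literature.NumberTheory.Automorphic
open Literature.NumberTheory.GaloisRepresentations
open Literature.NumberTheory.GaloisRepresentations.GL2F3Lift
open Literature.NumberTheory.LFunctions
open WeierstrassCurve
open Matrix

set_option linter.dupNamespace false

namespace Summit.ABC.ABC.Cruxes.FreyModularity.Sketch.StubModThreeIdeasK1G3

/-- The registered stub statement, verbatim. -/
def StubModThree : Prop :=
  ∀ (W : WeierstrassCurve ℚ) [W.IsElliptic] (ρ : ModPGaloisRep ℚ (ZMod 3) 2),
    W.IsTorsionGaloisRep 3 ρ → FramedRep.IsAbsolutelyIrreducible ρ → ρ.IsModular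

/-- The prime of `ℚ` under a finite place, as a natural number. -/
abbrev placePrime (v : HeightOneSpectrum (𝓞 ℚ)) : ℕ :=
  ((Rat.HeightOneSpectrum.primesEquiv v : Nat.Primes) : ℕ)

/-! ## Gen-2 pieces used by name (all PROVED in `…Sketch.StubModThreeIdeasK1G2`) -/

/-- gen-2 **H0** (proved there; 3-line proof repeated so this file is self-contained). -/
theorem isOdd_of_isTorsionGaloisRep_three (W : WeierstrassCurve ℚ) [W.IsElliptic]
    (ρ : ModPGaloisRep ℚ (ZMod 3) 2) (hρ : W.IsTorsionGaloisRep 3 ρ) :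
    FramedGaloisRep.IsOdd ρ := by
  haveI : NeZero ((3 : ℕ) : ℚ) := ⟨by norm_num⟩
  exact ModPGaloisRep.isOdd_of_det_eq_modPCyclotomicCharacterZMod ρ
    (W.det_eq_modPCyclotomicCharacter_of_isTorsionGaloisRep_holds 3 ρ hρ)

/-- gen-2 **H1** as a Prop (PROVED in gen 2 as `isModular_of_langlands_tunnell_at`): per-`σ`
Langlands–Tunnell descent. -/
def H1PerSigmaDescent : Prop :=
  ∀ ρ : ModPGaloisRep ℚ (ZMod 3) 2, langlands_tunnell (modThreeLift ρ) →
    FramedRep.IsAbsolutelyIrreducible ρ → FramedGaloisRep.IsOdd ρ → ρ.IsModular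

/-- gen-2 **H3** as a Prop (PROVED in gen 2 as `isDihedralType_or_isOctahedralType_modThreeLift`). -/
def H3DihedralOrOctahedral : Prop :=
  ∀ ρ : ModPGaloisRep ℚ (ZMod 3) 2, FramedRep.IsAbsolutelyIrreducible ρ → FramedGaloisRep.IsOdd ρ →
    IsDihedralType (modThreeLift ρ).toMonoidHom ∨ IsOctahedralType (modThreeLift ρ).toMonoidHom

/-- gen-2 **H4** (proved there; repeated, 8 lines): Langlands–Tunnell for ONE `σ` from `π(σ)` and
Gelbart Prop. 4.2; Prop. 4.1 is the tree THEOREM `frobSatakeCompatibleAt_of_isPiOfArtinRep_holds`. -/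
theorem langlands_tunnell_of_exists_isPiOfArtinRep (hW1 : exists_isNewform1_of_isPiOfArtinRep)
    (σ : FramedArtinRep ℚ 2)
    (hπ : σ.toGaloisRep.IsIrreducible →
      ∃ (hcpt : isCompact_glFiniteIntegralLevel 2 ℚ) (π : CuspidalAutomorphicRepData 2 ℚ hcpt),
        IsPiOfArtinRep σ π.1) :
    langlands_tunnell σ := by
  intro hirr hodd _hsolv
  obtain ⟨hcpt, π, hπ⟩ := hπ hirr
  obtain ⟨N, hN, f, hf, -, hsat⟩ := hW1 hcpt σ π hirr hodd hπ
  refine ⟨N, hN, f, hf, fun v hv => ?_⟩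
  obtain ⟨α, hα, hpoly⟩ := hsat v hv
  obtain ⟨hur, hchar⟩ := frobSatakeCompatibleAt_of_isPiOfArtinRep_holds hcpt σ π hπ v α hα
  exact ⟨hur, hpoly ▸ hchar⟩

/-! ## Plan S — semistable away from `3` + absolutely irreducible ⇒ surjective (Serre-type rigidity) -/

/-- **S1** (group theory in `GL₂(𝔽₃)`) — ALREADY PROVED IN THE TREE as Serre 1972 Prop. 15,
`Literature.GroupTheory.SpecificGroups.range_toGL_le_of_dvd_card_of_no_invariant_line`: a subgroup of
order divisible by `3` with no invariant line contains `SL₂(𝔽₃)`.  One-line import (PROVED here). -/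
theorem sl_le_of_three_dvd_card (G : Subgroup (GL (Fin 2) (ZMod 3)))
    (h3 : 3 ∣ Nat.card G)
    (hirr : ∀ v : Fin 2 → ZMod 3, v ≠ 0 →
      ∃ g ∈ G, ∀ c : ZMod 3, (g : Matrix (Fin 2) (Fin 2) (ZMod 3)) *ᵥ v ≠ c • v) :
    (Matrix.SpecialLinearGroup.toGL : SL(2, ZMod 3) →* GL (Fin 2) (ZMod 3)).range ≤ G := by
  haveI : Fact (Nat.Prime 3) := ⟨by norm_num⟩
  exact Literature.GroupTheory.SpecificGroups.range_toGL_le_of_dvd_card_of_no_invariant_line G h3 hirr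

/-- **S2** (arithmetic, M; in print: Edixhoven in Cornell–Silverman–Stevens, proof of Prop. 2.1, case
`p = 3`, p. 286): a mod-`3` representation of `Γ_ℚ` with `2`-group image (`3 ∤ #im ρ̄`) unramified at
every prime `≠ 3` is NOT absolutely irreducible.  (S2a, group theory by hand on the subgroups of a
`2`-Sylow `SD₁₆` of `GL₂(𝔽₃)`: an absolutely irreducible `2`-group image is non-abelian, hence has two
distinct index-`2` subgroups; S2b, arithmetic from the tree's PROVED `artinReciprocity_rankOne_holds`
over `ℚ` + Frobenius density: a quadratic character of `Γ_ℚ` unramified outside `3` has a ray-class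
partner mod `3^k`, and `(ℤ/3^k)ˣ` has exactly one character of order `2` — so `ℚ(√-3)` is the only
quadratic field unramified outside `3∞`; no Kronecker–Weber needed.) -/
theorem not_isAbsolutelyIrreducible_of_twoGroup_unramified (ρ : ModPGaloisRep ℚ (ZMod 3) 2)
    (h2 : ¬ 3 ∣ Nat.card ρ.toMonoidHom.range)
    (hunr : ∀ v : HeightOneSpectrum (𝓞 ℚ), placePrime v ≠ 3 → ρ.IsUnramifiedAt v) :
    ¬ FramedRep.IsAbsolutelyIrreducible ρ := by
  sorry

/-- **S3** (semistable ⇒ unipotent inertia, M): at a place `v ∤ 3` of semistable reduction the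
`3`-torsion has an inertia-fixed point (`exists_ne_zero_smul_eq_of_not_hasAdditiveReductionAt`,
landed in `Theorems/DefiniteXiFreyModularityStubNineTransfer`) and `det ρ̄ = χ̄₃` is unramified at
`v`, so `ρ̄(I_v)` is unipotent of exponent `3`; if `3 ∤ #im ρ̄` it is trivial. -/
theorem isUnramifiedAt_of_isSemistableAt_of_not_three_dvd (W : WeierstrassCurve ℚ) [W.IsElliptic]
    (ρ : ModPGaloisRep ℚ (ZMod 3) 2) (hρ : W.IsTorsionGaloisRep 3 ρ)
    (v : HeightOneSpectrum (𝓞 ℚ)) (hv : placePrime v ≠ 3) (hss : W.IsSemistableAt v)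
    (h2 : ¬ 3 ∣ Nat.card ρ.toMonoidHom.range) : ρ.IsUnramifiedAt v := by
  sorry

/-- **S0** (assembly of S1–S3, S-sized glue): `E/ℚ` semistable at every prime `≠ 3` with `E[3]`
absolutely irreducible has SURJECTIVE `ρ̄_{E,3}`.  (In print: Serre 1972 §5.4 Prop. 21 / Oesterlé–Edixhoven Prop. 2.1 [Cornell–Silverman–Stevens
p. 285–286], here with semistability needed only AWAY from `3`.  If `3 ∣ #im ρ̄`: S1 + `det ρ̄ = χ̄₃` onto `𝔽₃ˣ`
(oddness, H0) give `im ρ̄ = GL₂(𝔽₃)`.  If not: S3 at every `v ∤ 3`, then S2 contradicts `habs`.) -/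
theorem surjective_of_isSemistable_awayThree (W : WeierstrassCurve ℚ) [W.IsElliptic]
    (ρ : ModPGaloisRep ℚ (ZMod 3) 2) (hρ : W.IsTorsionGaloisRep 3 ρ)
    (habs : FramedRep.IsAbsolutelyIrreducible ρ)
    (hss : ∀ v : HeightOneSpectrum (𝓞 ℚ), placePrime v ≠ 3 → W.IsSemistableAt v) :
    Function.Surjective ρ := by
  sorry

/-- The **surjective core** of the stub (k3's `tunnellCore` without its `4 ∣ N` clause): modularity of
`ρ̄_{E,3}` when it is ONTO `GL₂(𝔽₃)`.  PROVED below from {`strongArtin_of_isOctahedralType`,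
`exists_isNewform1_of_isPiOfArtinRep`} granted gen-2's H1 and O1. -/
def SurjectiveCore : Prop :=
  ∀ (W : WeierstrassCurve ℚ) [W.IsElliptic] (ρ : ModPGaloisRep ℚ (ZMod 3) 2),
    W.IsTorsionGaloisRep 3 ρ → Function.Surjective ρ → ρ.IsModular

/-- **O1** (S): a surjective `ρ̄ : Γ_ℚ ↠ GL₂(𝔽₃)` has octahedral projective type after the lift `Ψ`
(`PGL₂(𝔽₃) ≃ S₄`; the projective image of `Ψ ∘ ρ̄` is that of `ρ̄`). -/
theorem isOctahedralType_modThreeLift_of_surjective (ρ : ModPGaloisRep ℚ (ZMod 3) 2)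
    (hs : Function.Surjective ρ) : IsOctahedralType (modThreeLift ρ).toMonoidHom := by
  sorry

/-- ★ **SurjectiveCore from two named facts** (PROVED modulo O1 and gen-2's proved H1). -/
theorem surjectiveCore_of_octahedral (hH1 : H1PerSigmaDescent)
    (ho : strongArtin_of_isOctahedralType) (hW1 : exists_isNewform1_of_isPiOfArtinRep) :
    SurjectiveCore := by
  intro W _ ρ hρ hs
  have habs : FramedRep.IsAbsolutelyIrreducible ρ :=
    (BCDT.isAbsIrreducibleOverSqrt_neg_three_of_surjective ρ hs).isAbsolutelyIrreducible
  have hodd := isOdd_of_isTorsionGaloisRep_three W ρ hρ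
  refine hH1 ρ ?_ habs hodd
  exact langlands_tunnell_of_exists_isPiOfArtinRep hW1 (modThreeLift ρ) fun hirr ↦
    ho (modThreeLift ρ) hirr (isOctahedralType_modThreeLift_of_surjective ρ hs)

/-- ★ **Semistable use-site**: for `E` semistable away from `3` the stub instance needs ONLY the
surjective core (so only Tunnell-octahedral + Gelbart 4.2 among the named facts).  PROVED from S0. -/
theorem isModular_of_isSemistable_awayThree (hcore : SurjectiveCore) (W : WeierstrassCurve ℚ)
    [W.IsElliptic] (ρ : ModPGaloisRep ℚ (ZMod 3) 2) (hρ : W.IsTorsionGaloisRep 3 ρ)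
    (habs : FramedRep.IsAbsolutelyIrreducible ρ)
    (hss : ∀ v : HeightOneSpectrum (𝓞 ℚ), placePrime v ≠ 3 → W.IsSemistableAt v) : ρ.IsModular :=
  hcore W ρ hρ (surjective_of_isSemistable_awayThree W ρ hρ habs hss)

/-! ## Plan D — the Cartan-normaliser (dihedral) case from the Γ₁ CM-newform fact, at the mod-3 level -/

/-- **D1** (`ρ̄ ⊗ 𝔽₉` is induced from an imaginary quadratic field, M): for `ρ̄` odd, absolutely
irreducible and of dihedral type there are an imaginary quadratic `K` (complex conjugation is never in
the Cartan: `n = 3` forced, `n = 2` by choice among three index-two subgroups, `n = 4` since the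
involutions of `C_ns ≃ C₈` have `det = 1`), a finite field `k' ⊇ 𝔽₃` and a character `χ̄ : Γ_K → k'ˣ`
with: at every place `v` of `ℚ` unramified in `K` above which `χ̄` is unramified, `ρ̄` is unramified and
`charpoly ρ̄(Frob_v) = ∏_{w ∣ v} (X^{f_w} - χ̄(Frob_w))` (`FramedGaloisRep.hasFrobCharpolyAt_induce`
after `ρ̄ ⊗ k' ≃ Ind χ̄` in an eigenbasis of the Cartan). -/
theorem exists_isInduced_of_isDihedralType (ρ : ModPGaloisRep ℚ (ZMod 3) 2)
    (habs : FramedRep.IsAbsolutelyIrreducible ρ) (hodd : FramedGaloisRep.IsOdd ρ)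
    (hdih : IsDihedralType (modThreeLift ρ).toMonoidHom) :
    ∃ (K : Type) (_ : Field K) (_ : NumberField K) (_ : Module.finrank ℚ K = 2)
      (_ : ¬ IsTotallyReal K) (k' : Type) (_ : Field k') (_ : Fintype k') (_ : CharP k' 3)
      (_ : TopologicalSpace k') (_ : DiscreteTopology k') (j : ZMod 3 →+* k')
      (χ : ModPGaloisRep K k' 1) (a : HeightOneSpectrum (𝓞 K) → k'),
      (∀ w : HeightOneSpectrum (𝓞 K), χ.IsUnramifiedAt w → χ.HasFrobCharpolyAt w (X - C (a w))) ∧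
      ∀ v : HeightOneSpectrum (𝓞 ℚ), v.asIdeal.ramificationIdxIn (𝓞 K) = 1 →
        (∀ w : HeightOneSpectrum (𝓞 K), w.asIdeal.under (𝓞 ℚ) = v.asIdeal → χ.IsUnramifiedAt w) →
        ρ.IsUnramifiedAt v ∧
          FramedGaloisRep.HasFrobCharpolyAt v (inducedFrobPolynomial v (fun w => X - C (a w)))
            (FramedRep.baseChange j continuous_of_discreteTopology ρ : ModPGaloisRep ℚ k' 2) := by
  sorry

/-- **D2** (Hecke lift with Teichmüller congruence, M): for a mod-`3` character `χ̄` of an imaginary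
quadratic `K` and a prime `𝔓 ∣ 3` of `ℤ̄` there is an algebraic Hecke character `ψ` of `K` of infinity
type `(m, 0)` (some `m ≥ 1`), unramified wherever `χ̄` is (away from `3`), with algebraic-integer values
`ψ(ϖ_w) ≡ χ̄(Frob_w) (mod 𝔓)`.  Construction: `ψ = ω · λ`, `ω` = the reciprocity partner
(`artinReciprocity_rankOne_holds`, `HeckeCharacter.exists_of_isGrossencharakter`) of the Teichmüller
lift `T ∘ χ̄ : Γ_K → μ₈ ⊂ ℤ̄ˣ` (reduction `μ₈(ℤ̄) → (ℤ̄/𝔓)ˣ` is injective, `3 ∤ 8`), and `λ = Ψ^{3^r-1}`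
for the everywhere-unramified type-`(m₀,0)` character `Ψ` (`exists_hasInfinityType_pos_zero_unramified`,
PROVED) whose values lie in a number field with residue field `𝔽_{3^r}` at `𝔓`. -/
theorem exists_heckeCharacter_teichmueller_congr (K : Type) [Field K] [NumberField K]
    (h2 : Module.finrank ℚ K = 2) (hK : ¬ IsTotallyReal K)
    {k' : Type} [Field k'] [Fintype k'] [CharP k' 3] [TopologicalSpace k'] [DiscreteTopology k']
    (χ : ModPGaloisRep K k' 1) (a : HeightOneSpectrum (𝓞 K) → k')
    (ha : ∀ w : HeightOneSpectrum (𝓞 K), χ.IsUnramifiedAt w → χ.HasFrobCharpolyAt w (X - C (a w)))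
    (𝔓 : Ideal (integralClosure ℤ ℂ)) [𝔓.IsMaximal] (h𝔓 : (3 : integralClosure ℤ ℂ) ∈ 𝔓)
    (ι : k' →+* integralClosure ℤ ℂ ⧸ 𝔓) :
    ∃ (m : ℕ) (ψ : HeckeCharacter K), 1 ≤ m ∧
      (ψ.HasInfinityType (fun _ => (m : ℤ)) (fun _ => 0) ∨
        ψ.HasInfinityType (fun _ => 0) (fun _ => (m : ℤ))) ∧
      ∀ w : HeightOneSpectrum (𝓞 K), (3 : 𝓞 K) ∉ w.asIdeal → χ.IsUnramifiedAt w →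
        ψ.IsUnramifiedAt w ∧
          ∃ b : integralClosure ℤ ℂ, (b : ℂ) = ψ.valueAtUniformizer w ∧
            Ideal.Quotient.mk 𝔓 b = ι (a w) := by
  sorry

/-- **D3** (ramification compatibility of the reciprocity partner — the ONE class-field-theoretic risk,
M–L): if a Hecke character `ω` and a rank-one Artin representation `θ` of `K` have the same Frobenius /
uniformizer values off a finite set, then `ω` unramified at `w` forces `θ` unramified at `w`.
(`artinReciprocity_rankOne_holds` already gives a ray-class partner `χ mod 𝔣` with `supp 𝔣 = ram θ`
EXACTLY; what is missing is that the idelic avatar of `χ` is ramified at every `w ∣ 𝔣`, i.e. the local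
reciprocity map takes `𝓞_wˣ` ONTO inertia — for the CYCLIC extension cut out by `θ` this is the unit
norm index `[U_w : N U] = e_w` (Herbrand, in the tree's `UnitsHerbrand…of_isCyclic`) plus the kernel
theorem; else vendored from Neukirch VI (6.6) / Tate §5.) -/
theorem isUnramifiedAt_artin_of_isUnramifiedAt_hecke (K : Type) [Field K] [NumberField K]
    (θ : FramedArtinRep K 1) (ω : HeckeCharacter K) (S : Set (HeightOneSpectrum (𝓞 K)))
    (hS : S.Finite)
    (hagree : ∀ w ∉ S, ω.IsUnramifiedAt w ∧ GaloisRep.IsUnramifiedAt w θ.toArtinRep ∧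
      ∀ 𝔓 ∈ w.primesAbove, ∀ σ : Field.absoluteGaloisGroup K, IsArithFrobAt (𝓞 K) σ 𝔓 →
        ω.valueAtUniformizer w = (FramedRep.det θ σ : ℂ))
    (w : HeightOneSpectrum (𝓞 K)) (hw : ω.IsUnramifiedAt w) :
    GaloisRep.IsUnramifiedAt w θ.toArtinRep := by
  sorry

/-- **D0** (assembly of the dihedral case, M bookkeeping = gen-2 H1's second half): granted the Γ₁
CM-newform fact, an odd absolutely irreducible `ρ̄` of dihedral type is modular.  (D1 gives `K, χ̄, a`;
pick `𝔓 ∣ 3` in `ℤ̄` and `ι : k' ↪ ℤ̄/𝔓`; D2 gives `ψ` of type `(m,0)`; the fact at weight `k = m+1 ≥ 2`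
gives a newform `f ∈ S_k(Γ₁(N_f))` with `heckePolynomial_p(f) = ∏_{w∣p}(X^{f_w} - ψ(ϖ_w))` in `ℂ[X]`
and `p ∤ N_f ⇒ p` unramified in `K`, `ψ` unramified above `p`; D3 (with `θ = T∘χ̄`) turns the latter
into `χ̄` unramified above `p`, so D1 applies: `ρ̄` unramified at `p` and, reducing the (algebraic-
integer) identity mod `𝔓`, `charpoly (ρ̄ ⊗ ℤ̄/𝔓)(Frob_p) = heckePolynomial_p(f) mod 𝔓` for every
`p ∤ 3 N_f` — which is `ρ̄.IsModular` with `w = m + 1`, `K = ℤ̄/𝔓` (ANY weight is allowed there).) -/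
theorem isModular_of_isDihedralType_of_cmFact (hCM : Ribet1977_cmNewform_of_heckeCharacter)
    (ρ : ModPGaloisRep ℚ (ZMod 3) 2) (habs : FramedRep.IsAbsolutelyIrreducible ρ)
    (hodd : FramedGaloisRep.IsOdd ρ) (hdih : IsDihedralType (modThreeLift ρ).toMonoidHom) :
    ρ.IsModular := by
  sorry

/-- ★ **Plan D closer** (PROVED modulo D0 and gen-2's proved H1, H3): the stub from THREE named facts
{`Ribet1977_cmNewform_of_heckeCharacter` (Hecke–Shimura–Ribet, Γ₁ CM newforms over ℚ),
`strongArtin_of_isOctahedralType` (Tunnell), `exists_isNewform1_of_isPiOfArtinRep` (Gelbart 4.2)} —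
Jacquet–Langlands §12 (`strongArtin_of_isDihedralType`) and Langlands' tetrahedral theorem unused. -/
theorem stub_modThree_of_cmFact_octahedral (hH1 : H1PerSigmaDescent) (hH3 : H3DihedralOrOctahedral)
    (hCM : Ribet1977_cmNewform_of_heckeCharacter) (ho : strongArtin_of_isOctahedralType)
    (hW1 : exists_isNewform1_of_isPiOfArtinRep) : StubModThree := by
  intro W _ ρ hρ habs
  have hodd := isOdd_of_isTorsionGaloisRep_three W ρ hρ
  rcases hH3 ρ habs hodd with hdih | hoct
  · exact isModular_of_isDihedralType_of_cmFact hCM ρ habs hodd hdih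
  · exact hH1 ρ (langlands_tunnell_of_exists_isPiOfArtinRep hW1 (modThreeLift ρ) fun hirr ↦
      ho (modThreeLift ρ) hirr hoct) habs hodd

end Summit.ABC.ABC.Cruxes.FreyModularity.Sketch.StubModThreeIdeasK1G3
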